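import Summits.CriticalPhenomena.PercolationContinuityZ3.Theorems.PercAnnulusCrossingIICErgodic
import HarnessLib

/-!
# Two far windows of the IIC are asymptotically independent and critical: `ν({ω + u ∈ E₁} ∩ {ω + v ∈ E₂}) ≈ P_{p_c}(E₁)·P_{p_c}(E₂)` (lane RSW3, p1 gen 7)

builds on p205010 (kernel theorem, internal audit signed; external expert review pending) — used only through the (A2)□ ⇒ one-arm
quasi-multiplicativity bridge and `CSH.percolationContinuity_allDimensions` (the `p_c(ℤ^d)` statement); the `ℤ²` statement is unconditional.

Seat `prim-rsw3-p1` (gen 7).  Two-window (finite-dimensional) form of the local limit `ν ∘ τ_v ⇒ P_{p_c}`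
(`PercAnnulusCrossingIICLocalLimitShift.lean`) obtained from UNIFORM MIXING (`PercAnnulusCrossingIICErgodic.lean`): for cylinder events
`E₁`, `E₂` and translations `u`, `v` taking both windows off `Λ(n₀)` with disjoint edge sets,
`|ν({ω + u ∈ E₁} ∩ {ω + v ∈ E₂}) − P_{p_c}(E₁)·P_{p_c}(E₂)| ≤ ε`: the joint law of two far-apart, far-from-the-root windows of Kesten's
IIC is that of two independent critical percolation windows, up to `ε`.

* **`iicMeasure_abs_real_inter_shift_shift_sub_le_criticalProbI`** (ℤ^d under (A2)□), **`…_Z2`** (unconditional).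

Helper file for the crux `stmt-CriticalPhenomena-4575` chain; no definitions, no sorries.
References: H. Kesten, PTRF 73 (1986) 369–394, Thm. (3), (1.12)–(1.13); G. Grimmett, *Percolation* (1999), §2.2.
-/

noncomputable section

namespace Summit.CriticalPhenomena.PercolationContinuityZ3.Theorems.Crossing

open MeasureTheory ProbabilityTheory Filter Topology
open Literature.Probability.Percolation Literature.Probability.LatticeModels
open Literature.Probability.Percolation.DCT16
open scoped ENNReal ProbabilityTheory Literature.Probability.Percolation

variable {d : ℕ}

/-- **TWO FAR WINDOWS OF THE IIC ARE ASYMPTOTICALLY INDEPENDENT AND CRITICAL (ℤ^d, under (A2)□)**: at `p_c(ℤ^d)`, `d ≥ 2`, under (A2)□ at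
aspect `(s,L)`, for every probability measure `ν` with Kesten's IIC limit property, cylinder events `E₁`, `E₂` (edge sets `F₁`, `F₂`,
endpoints in `W₁`, `W₂`) and `ε > 0` there is `n₀` such that for all translations `u`, `v` with `W₁ − u` and `W₂ − v` off `Λ(n₀)` and
`F₁ − u`, `F₂ − v` disjoint: **`|ν({ω | ω + u ∈ E₁} ∩ {ω | ω + v ∈ E₂}) − P_{p_c}(E₁)·P_{p_c}(E₂)| ≤ ε`**.
[cite: Kesten1986, Thm. (3), (1.12)–(1.13)] [cite: BasuSapozhnikov2017ECP, Thm. 1.1 and §1 (A2)] -/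
theorem iicMeasure_abs_real_inter_shift_shift_sub_le_criticalProbI (hd : 2 ≤ d) {s L : ℕ} (hs : 2 ≤ s) (hsL : s ≤ L) {ϰ : ℝ}
    (hϰ : 0 < ϰ) (hA2 : SetToSetQuasiMultAspectAt d (criticalProbI d) s L ϰ) {ν : Measure (BondConfig (Site d))}
    [IsProbabilityMeasure ν]
    (hν : ∀ (F : Finset (Sym2 (Site d))) (E : Set (BondConfig (Site d))), MeasurableSet E → DeterminedBy E ↑F →
      Tendsto (fun n : ℕ => (bondPercolation (zdGraph d) (criticalProbI d)).real (E ∩ siteToBoundary d n) /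
        oneArmProb d (criticalProbI d) n) atTop (𝓝 (ν.real E)))
    {F₁ F₂ : Finset (Sym2 (Site d))} {W₁ W₂ : Finset (Site d)} (hFW₁ : ∀ e ∈ F₁, ∀ w ∈ e, w ∈ W₁) (hFW₂ : ∀ e ∈ F₂, ∀ w ∈ e, w ∈ W₂)
    {E₁ E₂ : Set (BondConfig (Site d))} (hE₁ : DeterminedBy E₁ (↑F₁ : Set (Sym2 (Site d))))
    (hE₂ : DeterminedBy E₂ (↑F₂ : Set (Sym2 (Site d)))) {ε : ℝ} (hε : 0 < ε) :
    ∃ n₀ : ℕ, ∀ u v : Site d, (∀ w ∈ W₁, w - u ∉ box d n₀) → (∀ w ∈ W₂, w - v ∉ box d n₀) →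
      Disjoint (F₁.image (Sym2.map (Site.shift u).symm)) (F₂.image (Sym2.map (Site.shift v).symm)) →
      |ν.real (BondConfig.relabel (sym2Equiv (Site.shift u)) ⁻¹' E₁ ∩ BondConfig.relabel (sym2Equiv (Site.shift v)) ⁻¹' E₂) -
          (bondPercolation (zdGraph d) (criticalProbI d)).real E₁ * (bondPercolation (zdGraph d) (criticalProbI d)).real E₂| ≤ ε := by
  classical
  set μ := bondPercolation (zdGraph d) (criticalProbI d) with hμ
  have hε2 : 0 < ε / 2 := half_pos hε
  -- uniform mixing for the second window, the single-window bound for the first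
  obtain ⟨n₂, hn₂⟩ := iicMeasure_abs_real_inter_preimage_shift_sub_le_criticalProbI hd hs hsL hϰ hA2 hν hFW₂ hE₂ hε2
  obtain ⟨n₁, hn₁⟩ := iicMeasure_abs_real_inter_preimage_shift_sub_le_criticalProbI hd hs hsL hϰ hA2 hν hFW₁ hE₁ hε2
  refine ⟨max n₁ n₂, fun u v hu hv hdisj => ?_⟩
  have hu' : ∀ w ∈ W₁, w - u ∉ box d n₁ := fun w hw h => hu w hw (box_mono d (le_max_left _ _) h)
  have hv' : ∀ w ∈ W₂, w - v ∉ box d n₂ := fun w hw h => hv w hw (box_mono d (le_max_right _ _) h)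
  -- `|ν(S_u E₁ ∩ S_v E₂) − ν(S_u E₁) P(E₂)| ≤ ε/2`
  have h1 := hn₂ v hv' (F₁.image (Sym2.map (Site.shift u).symm)) (BondConfig.relabel (sym2Equiv (Site.shift u)) ⁻¹' E₁)
    (determinedBy_preimage_relabel_shift hE₁ u) hdisj
  -- `|ν(S_u E₁) − P(E₁)| ≤ ε/2` (the mixing bound with `G = univ`)
  have h2 := hn₁ u hu' ∅ Set.univ (determinedBy_univ _) (Finset.disjoint_empty_left _)
  rw [Set.univ_inter, probReal_univ, one_mul] at h2
  have hP₂ : 0 ≤ μ.real E₂ := measureReal_nonneg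
  have hP₂1 : μ.real E₂ ≤ 1 := measureReal_le_one
  have h3 : |ν.real (BondConfig.relabel (sym2Equiv (Site.shift u)) ⁻¹' E₁) * μ.real E₂ - μ.real E₁ * μ.real E₂| ≤ ε / 2 := by
    rw [← sub_mul, abs_mul, abs_of_nonneg hP₂]
    calc |ν.real (BondConfig.relabel (sym2Equiv (Site.shift u)) ⁻¹' E₁) - μ.real E₁| * μ.real E₂ ≤ ε / 2 * 1 :=
          mul_le_mul h2 hP₂1 hP₂ hε2.le
      _ = ε / 2 := mul_one _
  calc |ν.real (BondConfig.relabel (sym2Equiv (Site.shift u)) ⁻¹' E₁ ∩ BondConfig.relabel (sym2Equiv (Site.shift v)) ⁻¹' E₂) -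
          μ.real E₁ * μ.real E₂|
      = |(ν.real (BondConfig.relabel (sym2Equiv (Site.shift u)) ⁻¹' E₁ ∩ BondConfig.relabel (sym2Equiv (Site.shift v)) ⁻¹' E₂) -
            ν.real (BondConfig.relabel (sym2Equiv (Site.shift u)) ⁻¹' E₁) * μ.real E₂) +
          (ν.real (BondConfig.relabel (sym2Equiv (Site.shift u)) ⁻¹' E₁) * μ.real E₂ - μ.real E₁ * μ.real E₂)| := by ring_nf
    _ ≤ |ν.real (BondConfig.relabel (sym2Equiv (Site.shift u)) ⁻¹' E₁ ∩ BondConfig.relabel (sym2Equiv (Site.shift v)) ⁻¹' E₂) -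
            ν.real (BondConfig.relabel (sym2Equiv (Site.shift u)) ⁻¹' E₁) * μ.real E₂| +
          |ν.real (BondConfig.relabel (sym2Equiv (Site.shift u)) ⁻¹' E₁) * μ.real E₂ - μ.real E₁ * μ.real E₂| := abs_add_le _ _
    _ ≤ ε / 2 + ε / 2 := add_le_add h1 h3
    _ = ε := add_halves ε

/-- **TWO FAR WINDOWS OF THE PLANAR IIC ARE ASYMPTOTICALLY INDEPENDENT AND CRITICAL, unconditionally**: the same at `p_c(ℤ²) = 1/2`.
[cite: Kesten1986, Thm. (3), (1.12)–(1.13)] -/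
theorem iicMeasure_abs_real_inter_shift_shift_sub_le_Z2 {ν : Measure (BondConfig (Site 2))} [IsProbabilityMeasure ν]
    (hν : ∀ (F : Finset (Sym2 (Site 2))) (E : Set (BondConfig (Site 2))), MeasurableSet E → DeterminedBy E ↑F →
      Tendsto (fun n : ℕ => (bondPercolation (zdGraph 2) (criticalProbI 2)).real (E ∩ siteToBoundary 2 n) /
        oneArmProb 2 (criticalProbI 2) n) atTop (𝓝 (ν.real E)))
    {F₁ F₂ : Finset (Sym2 (Site 2))} {W₁ W₂ : Finset (Site 2)} (hFW₁ : ∀ e ∈ F₁, ∀ w ∈ e, w ∈ W₁) (hFW₂ : ∀ e ∈ F₂, ∀ w ∈ e, w ∈ W₂)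
    {E₁ E₂ : Set (BondConfig (Site 2))} (hE₁ : DeterminedBy E₁ (↑F₁ : Set (Sym2 (Site 2))))
    (hE₂ : DeterminedBy E₂ (↑F₂ : Set (Sym2 (Site 2)))) {ε : ℝ} (hε : 0 < ε) :
    ∃ n₀ : ℕ, ∀ u v : Site 2, (∀ w ∈ W₁, w - u ∉ box 2 n₀) → (∀ w ∈ W₂, w - v ∉ box 2 n₀) →
      Disjoint (F₁.image (Sym2.map (Site.shift u).symm)) (F₂.image (Sym2.map (Site.shift v).symm)) →
      |ν.real (BondConfig.relabel (sym2Equiv (Site.shift u)) ⁻¹' E₁ ∩ BondConfig.relabel (sym2Equiv (Site.shift v)) ⁻¹' E₂) -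
          (bondPercolation (zdGraph 2) (criticalProbI 2)).real E₁ * (bondPercolation (zdGraph 2) (criticalProbI 2)).real E₂| ≤ ε := by
  classical
  set μ := bondPercolation (zdGraph 2) (criticalProbI 2) with hμ
  have hε2 : 0 < ε / 2 := half_pos hε
  obtain ⟨n₂, hn₂⟩ := iicMeasure_abs_real_inter_preimage_shift_sub_le_Z2 hν hFW₂ hE₂ hε2
  obtain ⟨n₁, hn₁⟩ := iicMeasure_abs_real_inter_preimage_shift_sub_le_Z2 hν hFW₁ hE₁ hε2
  refine ⟨max n₁ n₂, fun u v hu hv hdisj => ?_⟩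
  have hu' : ∀ w ∈ W₁, w - u ∉ box 2 n₁ := fun w hw h => hu w hw (box_mono 2 (le_max_left _ _) h)
  have hv' : ∀ w ∈ W₂, w - v ∉ box 2 n₂ := fun w hw h => hv w hw (box_mono 2 (le_max_right _ _) h)
  have h1 := hn₂ v hv' (F₁.image (Sym2.map (Site.shift u).symm)) (BondConfig.relabel (sym2Equiv (Site.shift u)) ⁻¹' E₁)
    (determinedBy_preimage_relabel_shift hE₁ u) hdisj
  have h2 := hn₁ u hu' ∅ Set.univ (determinedBy_univ _) (Finset.disjoint_empty_left _)
  rw [Set.univ_inter, probReal_univ, one_mul] at h2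
  have hP₂ : 0 ≤ μ.real E₂ := measureReal_nonneg
  have hP₂1 : μ.real E₂ ≤ 1 := measureReal_le_one
  have h3 : |ν.real (BondConfig.relabel (sym2Equiv (Site.shift u)) ⁻¹' E₁) * μ.real E₂ - μ.real E₁ * μ.real E₂| ≤ ε / 2 := by
    rw [← sub_mul, abs_mul, abs_of_nonneg hP₂]
    calc |ν.real (BondConfig.relabel (sym2Equiv (Site.shift u)) ⁻¹' E₁) - μ.real E₁| * μ.real E₂ ≤ ε / 2 * 1 :=
          mul_le_mul h2 hP₂1 hP₂ hε2.le
      _ = ε / 2 := mul_one _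
  calc |ν.real (BondConfig.relabel (sym2Equiv (Site.shift u)) ⁻¹' E₁ ∩ BondConfig.relabel (sym2Equiv (Site.shift v)) ⁻¹' E₂) -
          μ.real E₁ * μ.real E₂|
      = |(ν.real (BondConfig.relabel (sym2Equiv (Site.shift u)) ⁻¹' E₁ ∩ BondConfig.relabel (sym2Equiv (Site.shift v)) ⁻¹' E₂) -
            ν.real (BondConfig.relabel (sym2Equiv (Site.shift u)) ⁻¹' E₁) * μ.real E₂) +
          (ν.real (BondConfig.relabel (sym2Equiv (Site.shift u)) ⁻¹' E₁) * μ.real E₂ - μ.real E₁ * μ.real E₂)| := by ring_nf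
    _ ≤ |ν.real (BondConfig.relabel (sym2Equiv (Site.shift u)) ⁻¹' E₁ ∩ BondConfig.relabel (sym2Equiv (Site.shift v)) ⁻¹' E₂) -
            ν.real (BondConfig.relabel (sym2Equiv (Site.shift u)) ⁻¹' E₁) * μ.real E₂| +
          |ν.real (BondConfig.relabel (sym2Equiv (Site.shift u)) ⁻¹' E₁) * μ.real E₂ - μ.real E₁ * μ.real E₂| := abs_add_le _ _
    _ ≤ ε / 2 + ε / 2 := add_le_add h1 h3
    _ = ε := add_halves ε

end Summit.CriticalPhenomena.PercolationContinuityZ3.Theorems.Crossing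

end
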